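import Summits.CriticalPhenomena.PercolationContinuityZ3.Theorems.PercNearOneGluingNoHeavyLowerTailKnQuestion8CoefficientwiseRootSetKernelRowTwoPrep
import Summits.CriticalPhenomena.PercolationContinuityZ3.Theorems.PercNearOneGluingNoHeavyLowerTailKnQuestion8CoefficientwiseRootSetKernelPathBound
import HarnessLib

/-!
# The root-set kernel, row 2 of RCSET with `q ≁ y` — the combinatorial core (abstract cluster maps) — prim-lf-2 gen 59

Support file (`--supports stmt-CriticalPhenomena-4575`, closed), prover `prim-lf-2` (gen 59).  No definitions, no named facts, no sorries; standard axioms.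
Memo `prim-lf-2/CW-KERNEL-gen59.md` §6.7; companions `…RootSetKernelRowTwoCore.lean` (the case `q ∼ y`), `…RootSetKernelRowTwoPrep.lean` (`skew_box_bound`, `split_box_bound`,
`sum_powerset_union_of_disjoint`), `…RootSetKernelPathBound.lean` (`path_box_bound`).

THE CORE (no `q–y` edges).  Two disjoint nonempty finsets of outer edges `Aq` (`U–q`) and `By` (`U–y`); `V = U ⊔ {q,y}`; monotone `f, g`; maps `R, P, B : Finset ι → Set V` (red
cluster of `S`, red cluster of `U`, blue cluster of `U`, as functions of the red outer edges `ω ⊆ Aq ∪ By`) with the axioms read off from connectivity when `q ≁ y`: `U ⊆ P ω, B ω`;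
`R` monotone, `R ∅ ⊆ U`; `y ∈ B ω` iff some `By` edge is blue, `q ∈ B ω` iff some `Aq` edge is blue, `y ∈ P ω` iff some `By` edge is red, `q ∈ P ω` iff some `Aq` edge is red;
`y ∉ R α` and `q ∉ R β` for `α ⊆ Aq`, `β ⊆ By`; and the EXPLORATION axiom `y ∉ R(α ∪ β) → R(α ∪ β) = R α`.
* `Coefficientwise.rcset_row_two_core_nonadj` — under these axioms `0 ≤ Σ_{ω ⊆ Aq ∪ By} [2·adm_S(ω) T(Rω,Bω) − adm_U(ω) T(Pω,Bω)]` (`adm_S = ¬(y∈Rω ∧ y∈Bω)`, etc.).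
Proof (memo §6.7): write `ω = α ∪ β`; a MIXED `α` contributes `Σ_β G_α(β)` with `G_α(By) + G_α(∅) = 2[T(A,Uq) + T(Q,V) − T(V,Uq)] ≥ 0` (`skew_box_bound`, `Q = Rα ⊆ A = R(α∪By)`) and
`G_α(β) ≥ 0` otherwise; the POOLED extreme pair `α ∈ {∅, Aq}` contributes `Σ_β [G_∅ + G_Aq](β)` with the `β ∈ {∅, By}` part equal to
`2[T(A,U) + T(c,V) − T(V,U)] + 2[T(Q,Uy) + T(Y,Uq) − T(Uq,Uy)] ≥ 0` (`split_box_bound` + `path_box_bound`; `c = R∅ ⊆ Q = R Aq ⊆ A = R(Aq∪By)`, `c ⊆ Y = R By ⊆ A`) and every other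
`β` contributing `2·[y∉R(Aq∪β)](T(Q,Uy) + T(c,V)) + … ≥ 0` (`skew_box_bound`).
[cite: KozmaNitzan2024, Questions 8–9 (§5.5 p. 36) (context: the Question-8 pocket covariance programme)]
-/

namespace Summit.CriticalPhenomena.PercolationContinuityZ3.Theorems

open Finset Literature.Probability.Percolation

namespace Coefficientwise

variable {ι V : Type*}

open Classical in
/-- **Row 2 of RCSET with `q ≁ y` — combinatorial core** (see the module docstring for the axioms on `R, P, B`). [cite: KozmaNitzan2024, Questions 8–9 (§5.5 p. 36) (context)] -/
theorem rcset_row_two_core_nonadj [DecidableEq ι] (Aq By : Finset ι) (hAqBy : Disjoint Aq By) (hAqne : Aq.Nonempty) (hByne : By.Nonempty)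
    (U : Finset V) (y q : V) (hyq : y ≠ q) (hyU : y ∉ U) (hqU : q ∉ U) (hUc : ∀ v : V, v ≠ q → v ≠ y → v ∈ U)
    (f g : Set V → ℝ) (hf : Monotone f) (hg : Monotone g) (R P B : Finset ι → Set V)
    (hUP : ∀ ω, (↑U : Set V) ⊆ P ω) (hUB : ∀ ω, (↑U : Set V) ⊆ B ω) (hRmono : ∀ ω ω' : Finset ι, ω ⊆ ω' → R ω ⊆ R ω') (hR0 : R ∅ ⊆ ↑U)
    (hyB : ∀ ω : Finset ι, y ∈ B ω ↔ ∃ j ∈ By, j ∉ ω) (hqB : ∀ ω : Finset ι, q ∈ B ω ↔ ∃ i ∈ Aq, i ∉ ω)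
    (hyP : ∀ ω : Finset ι, y ∈ P ω ↔ ∃ j ∈ By, j ∈ ω) (hqP : ∀ ω : Finset ι, q ∈ P ω ↔ ∃ i ∈ Aq, i ∈ ω)
    (hyA : ∀ α : Finset ι, α ⊆ Aq → y ∉ R α) (hqBy : ∀ β : Finset ι, β ⊆ By → q ∉ R β)
    (hexpl : ∀ α β : Finset ι, α ⊆ Aq → β ⊆ By → y ∉ R (α ∪ β) → R (α ∪ β) = R α) :
    0 ≤ ∑ ω ∈ (Aq ∪ By).powerset, (2 * (if ¬ (y ∈ R ω ∧ y ∈ B ω) then (f (R ω) - f (B ω)) * (g (R ω) - g (B ω)) else 0) -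
      (if ¬ (y ∈ P ω ∧ y ∈ B ω) then (f (P ω) - f (B ω)) * (g (P ω) - g (B ω)) else 0)) := by
  -- notation
  set TS : Finset ι → ℝ := fun ω => (f (R ω) - f (B ω)) * (g (R ω) - g (B ω)) with hTS
  set TU : Finset ι → ℝ := fun ω => (f (P ω) - f (B ω)) * (g (P ω) - g (B ω)) with hTU
  set G : Finset ι → ℝ := fun ω => 2 * (if ¬ (y ∈ R ω ∧ y ∈ B ω) then TS ω else 0) - (if ¬ (y ∈ P ω ∧ y ∈ B ω) then TU ω else 0) with hG
  change 0 ≤ ∑ ω ∈ (Aq ∪ By).powerset, G ω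
  rw [sum_powerset_union_of_disjoint Aq By hAqBy G]
  /- vertices -/
  have fill : ∀ X : Set V, (↑U : Set V) ⊆ X → ∀ v, v ≠ q → v ≠ y → v ∈ X := fun X hUX v h1 h2 => hUX (Finset.mem_coe.mpr (hUc v h1 h2))
  -- the four outer-vertex patterns of a set containing `U`
  have set_eq : ∀ X : Set V, (↑U : Set V) ⊆ X → ∀ (bq bY : Bool), (q ∈ X ↔ bq = true) → (y ∈ X ↔ bY = true) →
      X = {v | v ∈ (↑U : Set V) ∨ (v = q ∧ bq = true) ∨ (v = y ∧ bY = true)} := by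
    intro X hUX bq bY hq hy
    ext v
    simp only [Set.mem_setOf_eq]
    constructor
    · intro hv
      by_cases h1 : v = q
      · subst h1; exact Or.inr (Or.inl ⟨rfl, hq.mp hv⟩)
      by_cases h2 : v = y
      · subst h2; exact Or.inr (Or.inr ⟨rfl, hy.mp hv⟩)
      exact Or.inl (Finset.mem_coe.mpr (hUc v h1 h2))
    · rintro (hv | ⟨rfl, h⟩ | ⟨rfl, h⟩)
      · exact hUX hv
      · exact hq.mpr h
      · exact hy.mpr h
  -- names for the four sets
  set SU : Set V := {v | v ∈ (↑U : Set V) ∨ (v = q ∧ false = true) ∨ (v = y ∧ false = true)} with hSU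
  set SUq : Set V := {v | v ∈ (↑U : Set V) ∨ (v = q ∧ true = true) ∨ (v = y ∧ false = true)} with hSUq
  set SUy : Set V := {v | v ∈ (↑U : Set V) ∨ (v = q ∧ false = true) ∨ (v = y ∧ true = true)} with hSUy
  set SV : Set V := {v | v ∈ (↑U : Set V) ∨ (v = q ∧ true = true) ∨ (v = y ∧ true = true)} with hSV
  have hSU_sub_SUq : SU ⊆ SUq := by intro v hv; simp only [hSU, hSUq, Set.mem_setOf_eq] at hv ⊢; tauto
  have hSU_sub_SUy : SU ⊆ SUy := by intro v hv; simp only [hSU, hSUy, Set.mem_setOf_eq] at hv ⊢; tauto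
  have hSUq_sub_SV : SUq ⊆ SV := by intro v hv; simp only [hSUq, hSV, Set.mem_setOf_eq] at hv ⊢; tauto
  have hSUy_sub_SV : SUy ⊆ SV := by intro v hv; simp only [hSUy, hSV, Set.mem_setOf_eq] at hv ⊢; tauto
  have hU_SU : (↑U : Set V) ⊆ SU := fun v hv => Or.inl hv
  have hSV_univ : ∀ X : Set V, X ⊆ SV := by
    intro X v _
    by_cases h1 : v = q
    · exact Or.inr (Or.inl ⟨h1, rfl⟩)
    by_cases h2 : v = y
    · exact Or.inr (Or.inr ⟨h2, rfl⟩)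
    exact Or.inl (Finset.mem_coe.mpr (hUc v h1 h2))
  -- a set missing `y` and missing `q` and containing `U` is `SU`, etc. (as inclusions we need)
  have sub_SUq_of : ∀ X : Set V, y ∉ X → X ⊆ SUq := by
    intro X hyX v hv
    by_cases h1 : v = q
    · exact Or.inr (Or.inl ⟨h1, rfl⟩)
    have h2 : v ≠ y := fun h => hyX (h ▸ hv)
    exact Or.inl (Finset.mem_coe.mpr (hUc v h1 h2))
  have sub_SUy_of : ∀ X : Set V, q ∉ X → X ⊆ SUy := by
    intro X hqX v hv
    by_cases h2 : v = y
    · exact Or.inr (Or.inr ⟨h2, rfl⟩)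
    have h1 : v ≠ q := fun h => hqX (h ▸ hv)
    exact Or.inl (Finset.mem_coe.mpr (hUc v h1 h2))
  have sub_SU_of : ∀ X : Set V, q ∉ X → y ∉ X → X ⊆ SU := by
    intro X hqX hyX v hv
    have h1 : v ≠ q := fun h => hqX (h ▸ hv)
    have h2 : v ≠ y := fun h => hyX (h ▸ hv)
    exact Or.inl (Finset.mem_coe.mpr (hUc v h1 h2))
  /- values of `P` and `B` -/
  have P_eq : ∀ ω, P ω = {v | v ∈ (↑U : Set V) ∨ (v = q ∧ (decide (∃ i ∈ Aq, i ∈ ω)) = true) ∨ (v = y ∧ (decide (∃ j ∈ By, j ∈ ω)) = true)} := by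
    intro ω
    refine set_eq (P ω) (hUP ω) _ _ ?_ ?_
    · rw [hqP ω, decide_eq_true_iff]
    · rw [hyP ω, decide_eq_true_iff]
  have B_eq : ∀ ω, B ω = {v | v ∈ (↑U : Set V) ∨ (v = q ∧ (decide (∃ i ∈ Aq, i ∉ ω)) = true) ∨ (v = y ∧ (decide (∃ j ∈ By, j ∉ ω)) = true)} := by
    intro ω
    refine set_eq (B ω) (hUB ω) _ _ ?_ ?_
    · rw [hqB ω, decide_eq_true_iff]
    · rw [hyB ω, decide_eq_true_iff]
  obtain ⟨i₀, hi₀⟩ := hAqne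
  obtain ⟨j₀, hj₀⟩ := hByne
  have hAqBy' : ∀ i, i ∈ Aq → i ∉ By := fun i hi hj => Finset.disjoint_left.mp hAqBy hi hj
  -- membership simplifications for `ω = α ∪ β`, `α ⊆ Aq`, `β ⊆ By`
  have exA : ∀ α β : Finset ι, α ⊆ Aq → β ⊆ By → ((∃ i ∈ Aq, i ∈ α ∪ β) ↔ α.Nonempty) := by
    intro α β hα hβ
    constructor
    · rintro ⟨i, hi, hiu⟩
      rcases Finset.mem_union.mp hiu with h | h
      · exact ⟨i, h⟩
      · exact absurd (hβ h) (hAqBy' i hi)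
    · rintro ⟨i, hi⟩; exact ⟨i, hα hi, Finset.mem_union_left _ hi⟩
  have exB : ∀ α β : Finset ι, α ⊆ Aq → β ⊆ By → ((∃ j ∈ By, j ∈ α ∪ β) ↔ β.Nonempty) := by
    intro α β hα hβ
    constructor
    · rintro ⟨j, hj, hju⟩
      rcases Finset.mem_union.mp hju with h | h
      · exact absurd hj (hAqBy' j (hα h))
      · exact ⟨j, h⟩
    · rintro ⟨j, hj⟩; exact ⟨j, hβ hj, Finset.mem_union_right _ hj⟩
  have nexA : ∀ α β : Finset ι, α ⊆ Aq → β ⊆ By → ((∃ i ∈ Aq, i ∉ α ∪ β) ↔ α ≠ Aq) := by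
    intro α β hα hβ
    constructor
    · rintro ⟨i, hi, hiu⟩ h; subst h; exact hiu (Finset.mem_union_left _ hi)
    · intro hne
      obtain ⟨i, hi, hia⟩ := Finset.not_subset.mp (fun h => hne (Finset.Subset.antisymm hα h))
      exact ⟨i, hi, fun hu => (Finset.mem_union.mp hu).elim hia (fun h => hAqBy' i hi (hβ h))⟩
  have nexB : ∀ α β : Finset ι, α ⊆ Aq → β ⊆ By → ((∃ j ∈ By, j ∉ α ∪ β) ↔ β ≠ By) := by
    intro α β hα hβ
    constructor
    · rintro ⟨j, hj, hju⟩ h; subst h; exact hju (Finset.mem_union_right _ hj)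
    · intro hne
      obtain ⟨j, hj, hjb⟩ := Finset.not_subset.mp (fun h => hne (Finset.Subset.antisymm hβ h))
      exact ⟨j, hj, fun hu => (Finset.mem_union.mp hu).elim (fun h => hAqBy' j (hα h) hj) hjb⟩
  /- shorthand facts turning `P`, `B` into the four sets -/
  have P_is : ∀ α β : Finset ι, α ⊆ Aq → β ⊆ By → ∀ bq bY : Bool, (α.Nonempty ↔ bq = true) → (β.Nonempty ↔ bY = true) →
      P (α ∪ β) = {v | v ∈ (↑U : Set V) ∨ (v = q ∧ bq = true) ∨ (v = y ∧ bY = true)} := by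
    intro α β hα hβ bq bY h1 h2
    refine set_eq _ (hUP _) bq bY ?_ ?_
    · rw [hqP, exA α β hα hβ]; exact h1
    · rw [hyP, exB α β hα hβ]; exact h2
  have B_is : ∀ α β : Finset ι, α ⊆ Aq → β ⊆ By → ∀ bq bY : Bool, (α ≠ Aq ↔ bq = true) → (β ≠ By ↔ bY = true) →
      B (α ∪ β) = {v | v ∈ (↑U : Set V) ∨ (v = q ∧ bq = true) ∨ (v = y ∧ bY = true)} := by
    intro α β hα hβ bq bY h1 h2
    refine set_eq _ (hUB _) bq bY ?_ ?_
    · rw [hqB, nexA α β hα hβ]; exact h1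
    · rw [hyB, nexB α β hα hβ]; exact h2
  have hAq_ne : Aq ≠ ∅ := Finset.nonempty_iff_ne_empty.mp ⟨i₀, hi₀⟩
  have hBy_ne : By ≠ ∅ := Finset.nonempty_iff_ne_empty.mp ⟨j₀, hj₀⟩
  have tt : ∀ {p : Prop}, p → (p ↔ true = true) := fun h => ⟨fun _ => rfl, fun _ => h⟩
  have ff : ∀ {p : Prop}, ¬ p → (p ↔ false = true) := fun h => ⟨fun hp => absurd hp h, fun h' => absurd h' Bool.false_ne_true⟩
  -- the basic sets of `R`
  set c₀ : Set V := R ∅ with hc₀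
  set Q : Set V := R Aq with hQ
  set Y : Set V := R By with hY
  set A : Set V := R (Aq ∪ By) with hA
  have hc₀U : c₀ ⊆ SU := hR0.trans hU_SU
  have hc₀Q : c₀ ⊆ Q := hRmono _ _ (Finset.empty_subset _)
  have hc₀Y : c₀ ⊆ Y := hRmono _ _ (Finset.empty_subset _)
  have hQA : Q ⊆ A := hRmono _ _ Finset.subset_union_left
  have hYA : Y ⊆ A := hRmono _ _ Finset.subset_union_right
  have hQUq : Q ⊆ SUq := sub_SUq_of Q (hyA Aq subset_rfl)
  have hYUy : Y ⊆ SUy := sub_SUy_of Y (hqBy By subset_rfl)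
  /- split the `α`-sum: `∅`, `Aq`, and the mixed ones -/
  set F : Finset ι → ℝ := fun α => ∑ β ∈ By.powerset, G (α ∪ β) with hF
  change 0 ≤ ∑ α ∈ Aq.powerset, F α
  have h0mem : (∅ : Finset ι) ∈ Aq.powerset := Finset.mem_powerset.mpr (Finset.empty_subset _)
  have hAmem : Aq ∈ Aq.powerset.erase ∅ := Finset.mem_erase.mpr ⟨hAq_ne, Finset.mem_powerset.mpr subset_rfl⟩
  rw [← Finset.add_sum_erase _ _ h0mem, ← Finset.add_sum_erase _ _ hAmem, ← add_assoc]
  -- inner split of a `β`-sum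
  have hBmem0 : (∅ : Finset ι) ∈ By.powerset := Finset.mem_powerset.mpr (Finset.empty_subset _)
  have hBmemBy : By ∈ By.powerset.erase ∅ := Finset.mem_erase.mpr ⟨hBy_ne, Finset.mem_powerset.mpr subset_rfl⟩
  have splitB : ∀ φ : Finset ι → ℝ, ∑ β ∈ By.powerset, φ β = φ ∅ + φ By + ∑ β ∈ (By.powerset.erase ∅).erase By, φ β := by
    intro φ; rw [← Finset.add_sum_erase _ _ hBmem0, ← Finset.add_sum_erase _ _ hBmemBy, ← add_assoc]
  have memB3 : ∀ β, β ∈ (By.powerset.erase ∅).erase By → β ⊆ By ∧ β ≠ ∅ ∧ β ≠ By := by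
    intro β hβ
    obtain ⟨h1, h2⟩ := Finset.mem_erase.mp hβ
    obtain ⟨h3, h4⟩ := Finset.mem_erase.mp h2
    exact ⟨Finset.mem_powerset.mp h4, h3, h1⟩
  refine add_nonneg ?_ (Finset.sum_nonneg fun α hα => ?_)
  · /- the pooled pair `α ∈ {∅, Aq}` -/
    have hsum : F ∅ + F Aq = ∑ β ∈ By.powerset, (G (∅ ∪ β) + G (Aq ∪ β)) := by
      simp only [hF, ← Finset.sum_add_distrib]
    rw [hsum, splitB]
    -- values at the four extreme colourings
    have P1 : P (Aq ∪ By) = SV := P_is Aq By subset_rfl subset_rfl true true (tt ⟨i₀, hi₀⟩) (tt ⟨j₀, hj₀⟩)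
    have B1 : B (Aq ∪ By) = SU := B_is Aq By subset_rfl subset_rfl false false (ff (fun h => h rfl)) (ff (fun h => h rfl))
    have P2 : P (∅ ∪ By) = SUy := P_is ∅ By (Finset.empty_subset _) subset_rfl false true (ff Finset.not_nonempty_empty) (tt ⟨j₀, hj₀⟩)
    have B2 : B (∅ ∪ By) = SUq := B_is ∅ By (Finset.empty_subset _) subset_rfl true false (tt (fun h => hAq_ne h.symm)) (ff (fun h => h rfl))
    have P3 : P (Aq ∪ ∅) = SUq := P_is Aq ∅ subset_rfl (Finset.empty_subset _) true false (tt ⟨i₀, hi₀⟩) (ff Finset.not_nonempty_empty)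
    have B3 : B (Aq ∪ ∅) = SUy := B_is Aq ∅ subset_rfl (Finset.empty_subset _) false true (ff (fun h => h rfl)) (tt (fun h => hBy_ne h.symm))
    have P4 : P (∅ ∪ ∅) = SU := P_is ∅ ∅ (Finset.empty_subset _) (Finset.empty_subset _) false false (ff Finset.not_nonempty_empty) (ff Finset.not_nonempty_empty)
    have B4 : B (∅ ∪ ∅) = SV := B_is ∅ ∅ (Finset.empty_subset _) (Finset.empty_subset _) true true (tt (fun h => hAq_ne h.symm)) (tt (fun h => hBy_ne h.symm))
    have R1 : R (Aq ∪ By) = A := rfl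
    have R2 : R (∅ ∪ By) = Y := by rw [Finset.empty_union]
    have R3 : R (Aq ∪ ∅) = Q := by rw [Finset.union_empty]
    have R4 : R (∅ ∪ ∅) = c₀ := by rw [Finset.union_empty]
    have hySU : y ∉ SU := by intro h; rcases h with h | ⟨_, h⟩ | ⟨_, h⟩ <;> first | exact hyU (Finset.mem_coe.mp h) | exact Bool.false_ne_true h
    have hySUq : y ∉ SUq := by
      intro h; rcases h with h | ⟨h1, _⟩ | ⟨_, h⟩
      · exact hyU (Finset.mem_coe.mp h)
      · exact hyq h1
      · exact Bool.false_ne_true h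
    have G1 : G (Aq ∪ By) = 2 * TS (Aq ∪ By) - TU (Aq ∪ By) := by
      simp only [hG, B1, if_pos (fun h : y ∈ R (Aq ∪ By) ∧ y ∈ SU => hySU h.2), if_pos (fun h : y ∈ P (Aq ∪ By) ∧ y ∈ SU => hySU h.2)]
    have G2 : G (∅ ∪ By) = 2 * TS (∅ ∪ By) - TU (∅ ∪ By) := by
      simp only [hG, B2, if_pos (fun h : y ∈ R (∅ ∪ By) ∧ y ∈ SUq => hySUq h.2), if_pos (fun h : y ∈ P (∅ ∪ By) ∧ y ∈ SUq => hySUq h.2)]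
    have G3 : G (Aq ∪ ∅) = 2 * TS (Aq ∪ ∅) - TU (Aq ∪ ∅) := by
      have h1 : y ∉ R (Aq ∪ ∅) := by rw [Finset.union_empty]; exact hyA Aq subset_rfl
      have h2 : y ∉ P (Aq ∪ ∅) := by rw [P3]; exact hySUq
      simp only [hG, if_pos (fun h : y ∈ R (Aq ∪ ∅) ∧ y ∈ B (Aq ∪ ∅) => h1 h.1), if_pos (fun h : y ∈ P (Aq ∪ ∅) ∧ y ∈ B (Aq ∪ ∅) => h2 h.1)]
    have G4 : G (∅ ∪ ∅) = 2 * TS (∅ ∪ ∅) - TU (∅ ∪ ∅) := by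
      have h1 : y ∉ R (∅ ∪ ∅) := by rw [Finset.union_empty]; exact fun h => hySU (hc₀U h)
      have h2 : y ∉ P (∅ ∪ ∅) := by rw [P4]; exact hySU
      simp only [hG, if_pos (fun h : y ∈ R (∅ ∪ ∅) ∧ y ∈ B (∅ ∪ ∅) => h1 h.1), if_pos (fun h : y ∈ P (∅ ∪ ∅) ∧ y ∈ B (∅ ∪ ∅) => h2 h.1)]
    have four : 0 ≤ (G (∅ ∪ ∅) + G (Aq ∪ ∅)) + (G (∅ ∪ By) + G (Aq ∪ By)) := by
      rw [G1, G2, G3, G4]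
      simp only [hTS, hTU, P1, B1, P2, B2, P3, B3, P4, B4, R1, R2, R3, R4]
      have hLS := split_box_bound (fc := f c₀) (fI := f SU) (fA := f A) (fV := f SV) (gc := g c₀) (gI := g SU) (gA := g A) (gV := g SV)
        (hf hc₀U) (hf (hSV_univ A)) (hg hc₀U) (hg (hSV_univ A))
      have hPATH := path_box_bound (fc := f c₀) (fQ := f Q) (fY := f Y) (fA := f A) (fQ' := f SUq) (fY' := f SUy)
        (gc := g c₀) (gQ := g Q) (gY := g Y) (gA := g A) (gQ' := g SUq) (gY' := g SUy)
        (hf hc₀Q) (hf hQA) (hf hc₀Y) (hf hYA) (hf hQUq) (hf hYUy) (hg hc₀Q) (hg hQA) (hg hc₀Y) (hg hYA) (hg hQUq) (hg hYUy)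
      nlinarith [hLS, hPATH]
    refine add_nonneg four (Finset.sum_nonneg fun β hβ => ?_)
    obtain ⟨hβBy, hβ0, hβ1⟩ := memB3 β hβ
    have hβne : β.Nonempty := Finset.nonempty_of_ne_empty hβ0
    -- `α = Aq`: admU fails; admS ⇒ R = Q, B = SUy
    have BAq : B (Aq ∪ β) = SUy := B_is Aq β subset_rfl hβBy false true (ff (fun h => h rfl)) (tt hβ1)
    have PAq : P (Aq ∪ β) = SV := P_is Aq β subset_rfl hβBy true true (tt ⟨i₀, hi₀⟩) (tt hβne)
    have B0 : B (∅ ∪ β) = SV := B_is ∅ β (Finset.empty_subset _) hβBy true true (tt (fun h => hAq_ne h.symm)) (tt hβ1)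
    have P0 : P (∅ ∪ β) = SUy := P_is ∅ β (Finset.empty_subset _) hβBy false true (ff Finset.not_nonempty_empty) (tt hβne)
    have hyV : y ∈ SV := Or.inr (Or.inr ⟨rfl, rfl⟩)
    have hyUy : y ∈ SUy := Or.inr (Or.inr ⟨rfl, rfl⟩)
    have hPU1 : ¬ ¬ (y ∈ P (Aq ∪ β) ∧ y ∈ B (Aq ∪ β)) := not_not.mpr ⟨by rw [PAq]; exact hyV, by rw [BAq]; exact hyUy⟩
    have hPU2 : ¬ ¬ (y ∈ P (∅ ∪ β) ∧ y ∈ B (∅ ∪ β)) := not_not.mpr ⟨by rw [P0]; exact hyUy, by rw [B0]; exact hyV⟩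
    have GAq0 : G (Aq ∪ β) = 2 * (if ¬ (y ∈ R (Aq ∪ β) ∧ y ∈ B (Aq ∪ β)) then TS (Aq ∪ β) else 0) := by
      simp only [hG, if_neg hPU1, sub_zero]
    have G00 : G (∅ ∪ β) = 2 * (if ¬ (y ∈ R (∅ ∪ β) ∧ y ∈ B (∅ ∪ β)) then TS (∅ ∪ β) else 0) := by
      simp only [hG, if_neg hPU2, sub_zero]
    rw [GAq0, G00]
    by_cases hyR : y ∈ R (Aq ∪ β)
    · have hc1 : ¬ ¬ (y ∈ R (Aq ∪ β) ∧ y ∈ B (Aq ∪ β)) := not_not.mpr ⟨hyR, by rw [BAq]; exact hyUy⟩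
      rw [if_neg hc1, mul_zero, add_zero]
      refine mul_nonneg (by norm_num) ?_
      by_cases hc2 : y ∈ R (∅ ∪ β) ∧ y ∈ B (∅ ∪ β)
      · rw [if_neg (not_not.mpr hc2)]
      · rw [if_pos hc2]
        have hyR0 : y ∉ R (∅ ∪ β) := fun h' => hc2 ⟨h', by rw [B0]; exact hyV⟩
        have hR0 : R (∅ ∪ β) = c₀ := hexpl ∅ β (Finset.empty_subset _) hβBy hyR0
        simp only [hTS, hR0, B0]
        exact mul_nonneg_of_nonpos_of_nonpos (sub_nonpos.mpr (hf (hSV_univ _))) (sub_nonpos.mpr (hg (hSV_univ _)))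
    · have hyR0 : y ∉ R (∅ ∪ β) := fun h' => hyR (hRmono _ _ (Finset.union_subset_union (Finset.empty_subset _) subset_rfl) h')
      have hc3 : ¬ (y ∈ R (Aq ∪ β) ∧ y ∈ B (Aq ∪ β)) := fun h => hyR h.1
      have hc4 : ¬ (y ∈ R (∅ ∪ β) ∧ y ∈ B (∅ ∪ β)) := fun h => hyR0 h.1
      rw [if_pos hc3, if_pos hc4]
      have hRAq : R (Aq ∪ β) = Q := hexpl Aq β subset_rfl hβBy hyR
      have hR0 : R (∅ ∪ β) = c₀ := hexpl ∅ β (Finset.empty_subset _) hβBy hyR0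
      simp only [hTS, hRAq, hR0, BAq, B0]
      have key := skew_box_bound (fR := f c₀) (fA := f Q) (fB := f SUy) (fP := f SV) (gR := g c₀) (gA := g Q) (gB := g SUy) (gP := g SV)
        (hf hc₀Q) (hf (hSV_univ Q)) (hf (hc₀U.trans hSU_sub_SUy)) (hg hc₀Q) (hg (hSV_univ Q)) (hg (hc₀U.trans hSU_sub_SUy))
      nlinarith [key, mul_nonneg (sub_nonneg.mpr (hf hSUy_sub_SV)) (sub_nonneg.mpr (hg hSUy_sub_SV))]
  · /- a mixed `α` -/
    obtain ⟨hα1, hα2⟩ := Finset.mem_erase.mp hα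
    obtain ⟨hα0, hα3⟩ := Finset.mem_erase.mp hα2
    have hαAq : α ⊆ Aq := Finset.mem_powerset.mp hα3
    have hαne : α.Nonempty := Finset.nonempty_of_ne_empty hα0
    simp only [hF]
    rw [splitB]
    set Qa : Set V := R α with hQa
    set Aa : Set V := R (α ∪ By) with hAa
    have hQaAa : Qa ⊆ Aa := hRmono _ _ Finset.subset_union_left
    have hQaUq : Qa ⊆ SUq := sub_SUq_of Qa (hyA α hαAq)
    have PBy : P (α ∪ By) = SV := P_is α By hαAq subset_rfl true true (tt hαne) (tt ⟨j₀, hj₀⟩)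
    have BBy : B (α ∪ By) = SUq := B_is α By hαAq subset_rfl true false (tt hα1) (ff (fun h => h rfl))
    have P0 : P (α ∪ ∅) = SUq := P_is α ∅ hαAq (Finset.empty_subset _) true false (tt hαne) (ff Finset.not_nonempty_empty)
    have B0 : B (α ∪ ∅) = SV := B_is α ∅ hαAq (Finset.empty_subset _) true true (tt hα1) (tt (fun h => hBy_ne h.symm))
    have R0 : R (α ∪ ∅) = Qa := by rw [Finset.union_empty]
    have hySUq : y ∉ SUq := by
      intro h; rcases h with h | ⟨h1, _⟩ | ⟨_, h⟩
      · exact hyU (Finset.mem_coe.mp h)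
      · exact hyq h1
      · exact Bool.false_ne_true h
    have GBy : G (α ∪ By) = 2 * TS (α ∪ By) - TU (α ∪ By) := by
      simp only [hG, BBy, if_pos (fun h : y ∈ R (α ∪ By) ∧ y ∈ SUq => hySUq h.2), if_pos (fun h : y ∈ P (α ∪ By) ∧ y ∈ SUq => hySUq h.2)]
    have G0 : G (α ∪ ∅) = 2 * TS (α ∪ ∅) - TU (α ∪ ∅) := by
      have h1 : y ∉ R (α ∪ ∅) := by rw [Finset.union_empty]; exact hyA α hαAq
      have h2 : y ∉ P (α ∪ ∅) := by rw [P0]; exact hySUq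
      simp only [hG, if_pos (fun h : y ∈ R (α ∪ ∅) ∧ y ∈ B (α ∪ ∅) => h1 h.1), if_pos (fun h : y ∈ P (α ∪ ∅) ∧ y ∈ B (α ∪ ∅) => h2 h.1)]
    have two : 0 ≤ G (α ∪ ∅) + G (α ∪ By) := by
      rw [GBy, G0]
      simp only [hTS, hTU, PBy, BBy, P0, B0, R0]
      have key := skew_box_bound (fR := f Qa) (fA := f Aa) (fB := f SUq) (fP := f SV) (gR := g Qa) (gA := g Aa) (gB := g SUq) (gP := g SV)
        (hf hQaAa) (hf (hSV_univ Aa)) (hf hQaUq) (hg hQaAa) (hg (hSV_univ Aa)) (hg hQaUq)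
      nlinarith [key]
    refine add_nonneg two (Finset.sum_nonneg fun β hβ => ?_)
    obtain ⟨hβBy, hβ0, hβ1⟩ := memB3 β hβ
    have hβne : β.Nonempty := Finset.nonempty_of_ne_empty hβ0
    have Bb : B (α ∪ β) = SV := B_is α β hαAq hβBy true true (tt hα1) (tt hβ1)
    have Pb : P (α ∪ β) = SV := P_is α β hαAq hβBy true true (tt hαne) (tt hβne)
    have hyV : y ∈ SV := Or.inr (Or.inr ⟨rfl, rfl⟩)
    have hPU : ¬ ¬ (y ∈ P (α ∪ β) ∧ y ∈ B (α ∪ β)) := not_not.mpr ⟨by rw [Pb]; exact hyV, by rw [Bb]; exact hyV⟩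
    have Gb : G (α ∪ β) = 2 * (if ¬ (y ∈ R (α ∪ β) ∧ y ∈ B (α ∪ β)) then TS (α ∪ β) else 0) := by
      simp only [hG, if_neg hPU, sub_zero]
    rw [Gb]
    refine mul_nonneg (by norm_num) ?_
    by_cases hc : y ∈ R (α ∪ β) ∧ y ∈ B (α ∪ β)
    · rw [if_neg (not_not.mpr hc)]
    · rw [if_pos hc]
      have hyR : y ∉ R (α ∪ β) := fun h' => hc ⟨h', by rw [Bb]; exact hyV⟩
      have hR : R (α ∪ β) = Qa := hexpl α β hαAq hβBy hyR
      simp only [hTS, hR, Bb]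
      exact mul_nonneg_of_nonpos_of_nonpos (sub_nonpos.mpr (hf (hSV_univ _))) (sub_nonpos.mpr (hg (hSV_univ _)))

end Coefficientwise

end Summit.CriticalPhenomena.PercolationContinuityZ3.Theorems
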